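import Literature.NumberTheory.PAdicHodge.AinfRamifiedWitt
import Literature.NumberTheory.PAdicHodge.UnramifiedWittFixedFrobenius
import HarnessLib

/-!
# The Frobenius-twisted conjugate specialisation `ϑ_{j,ρ} : A_inf(𝒪_F) → 𝒪_{ℂ_F}`

Topic `Literature/NumberTheory/PAdicHodge`. For a `p`-adic field `F` with residue field `k_F = 𝔽_{p^f}`, an Eisenstein
datum `D` over `W(k_F)` (tree `EisensteinRootW`, `A_inf(𝒪_F) = 𝔸_inf(F)[X]/(E)`, tree `AinfRamW`), an integer `j` and a
root `ρ ∈ 𝒪_{ℂ_F}` of the **`φ^j`-twisted** Eisenstein polynomial `E^{(j)} = Σ θ(φ^j a_i) X^i`, we define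
**`ϑ_{j,ρ} := θ ∘ φ^j` on `𝔸_inf(F)`, `ϖ ↦ ρ`** (solo-Langlands-informed Stage E2.9a, memo `work/s113/E29.md` §2): the
specialisation along a `ℚ_p`-embedding `e` of `F` whose restriction to `W(k_F)` is `θ ∘ φ^j` and with `e(π) = ρ`.

* §1 the twisted coefficient character `c_j = θ ∘ φ^j ∘ (W(k_F) → 𝔸_inf(F))` and its values `wittToC (φ^j w)`;
  `Γ_F` commutes with `φ^j` on `𝔸_inf(F)`;
* §2 `ϑ_{j,ρ}` (`AinfRamW.thetaTwist`): values on `𝔸_inf(F)`, on `ϖ`, on the coefficient ring, and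
  **`Γ_F`-equivariance for `σ` with `σ(ρ) = ρ`** (`coe_thetaTwist_gal`);
* §3 **`θ ∘ φ^j ≡ Frob^j ∘ θ (mod p)`** on `𝔸_inf(F)` (`fontaineTheta_iterate_frobenius_sub_pow_mem`) and the
  ★ **level-one congruence `ϑ_{j,ρ}(x) − θ_𝒪(x)^{p^j} ∈ (ρ, p, π)𝒪_{ℂ_F}`** (`thetaTwist_sub_theta_pow_mem`), with its
  norm form `‖ϑ_{j,ρ}(x) − θ_𝒪(x)^{p^j}‖ ≤ ‖π‖` when `‖ρ‖ ≤ ‖π‖` (`norm_coe_thetaTwist_sub_theta_pow_le`).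

No named facts, no instances, no `sorry`.

## References
* J.-M. Fontaine, *Le corps des périodes p-adiques*, Astérisque 223 (1994), Exp. II §1.2. [FontaineAsterisque223III]
* L. Fargues, J.-M. Fontaine, *Courbes et fibrés vectoriels en théorie de Hodge p-adique*, Astérisque 406 (2018), §1.2, §2.2. [FarguesFontaine2018]
* J.-P. Serre, *Abelian ℓ-adic representations and elliptic curves* (1968), Ch. III §A.5. [SerreAbelianLadic1968]
* J.-P. Serre, *Local Fields* (GTM 67, 1979), Ch. I §6 Prop. 17. [SerreLocalFields1979]
-/

noncomputable section

open Polynomial IsLocalRing WittVector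

namespace Literature.NumberTheory.PAdicHodge

open Literature.NumberTheory.GaloisRepresentations
open Literature.NumberTheory.GaloisRepresentations.IsNonarchimedeanLocalField
open Field ValuativeRel

variable {F : Type} [Field F] [ValuativeRel F] [TopologicalSpace F] [IsNonarchimedeanLocalField F]
  [CharZero F] {p : ℕ} [Fact p.Prime]

section Ring

variable [Fact (¬ IsUnit (p : integerC F))] [IsAdicComplete (Ideal.span {(p : integerC F)}) (integerC F)]

/-! ## §1 The twisted coefficient character `c_j = θ ∘ φ^j ∘ (W(k_F) → 𝔸_inf(F))` -/

omit [CharZero F] [IsAdicComplete (Ideal.span {(p : integerC F)}) (integerC F)] in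
/-- `Γ_F` commutes with `φ^n` on `𝔸_inf(F)` (tree `galAinf_frobenius`). [cite: FontaineAsterisque223III, Exp. II §1.2] -/
theorem galAinf_iterate_frobenius (σ : absoluteGaloisGroup F) (n : ℕ) (x : Ainf (p := p) F) :
    galAinf σ ((⇑(WittVector.frobenius : Ainf (p := p) F →+* Ainf (p := p) F))^[n] x) =
      (⇑(WittVector.frobenius : Ainf (p := p) F →+* Ainf (p := p) F))^[n] (galAinf σ x) := by
  induction n with
  | zero => rfl
  | succ n ih => rw [Function.iterate_succ_apply', Function.iterate_succ_apply', galAinf_frobenius, ih]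

/-- **The `φ^j`-twisted coefficient character `c_j := θ ∘ φ^j ∘ (W(k_F) → 𝔸_inf(F)) : W(k_F) → 𝒪_{ℂ_F}`.**
[cite: FontaineAsterisque223III, Exp. II §1.2] -/
def twistCoeff (hp : valuation F p < 1) (j : ℕ) : wittFixed F p →+* integerC F :=
  (fontaineTheta (integerC F) p).comp
    (((WittVector.frobenius : Ainf (p := p) F →+* Ainf (p := p) F) ^ j).comp (wittFixedToAinf F p hp))

/-- Unfolding `c_j`. [cite: FontaineAsterisque223III, Exp. II §1.2] -/
theorem twistCoeff_apply (hp : valuation F p < 1) (j : ℕ) (w : wittFixed F p) :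
    twistCoeff hp j w = fontaineTheta (integerC F) p
      ((⇑(WittVector.frobenius : Ainf (p := p) F →+* Ainf (p := p) F))^[j] (wittFixedToAinf F p hp w)) := by
  rw [twistCoeff, RingHom.comp_apply, RingHom.comp_apply, RingHom.coe_pow]

/-- `c_0 = (W(k_F) → 𝒪_{ℂ_F})` (tree `wittFixedToIntC`). [cite: FontaineAsterisque223III, Exp. II §1.2] -/
theorem twistCoeff_zero (hp : valuation F p < 1) (w : wittFixed F p) :
    twistCoeff hp 0 w = wittFixedToIntC F p hp w := by
  rw [twistCoeff_apply, Function.iterate_zero_apply, fontaineTheta_wittFixedToAinf hp]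

/-- **`c_j(w) = wittToC (φ^j w)` in `ℂ_F`.** [cite: FontaineAsterisque223III, Exp. II §1.2] -/
theorem coe_twistCoeff (hp : valuation F p < 1) (j : ℕ) (w : wittFixed F p) :
    ((twistCoeff hp j w : integerC F) : CompletedAlgClosure F) =
      wittToC F p hp ((⇑(WittVector.frobenius : WittVector p (ResidueField (maxUnramifiedCompletion F)) →+*
        WittVector p (ResidueField (maxUnramifiedCompletion F))))^[j]
          (w : WittVector p (ResidueField (maxUnramifiedCompletion F)))) := by
  haveI : Fact (¬ IsUnit (p : maxUnramifiedCompletion F)) := ⟨not_isUnit_natCast_completion hp⟩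
  haveI : CharP (ResidueField (maxUnramifiedCompletion F)) p := charP_residueField_completion
  rw [twistCoeff_apply, wittFixedToAinf_apply, iterate_frobenius_wittToAinf, wittToC_apply]

/-- `c_j` takes `Γ_F`-invariant values (they lie in `wittToC(W(k_F)) ⊆ F`). [cite: FontaineAsterisque223III, Exp. II §1.2] -/
theorem galInt_twistCoeff (hp : valuation F p < 1) (j : ℕ) (σ : absoluteGaloisGroup F) (w : wittFixed F p) :
    galInt σ (twistCoeff hp j w) = twistCoeff hp j w := by
  rw [twistCoeff_apply, ← fontaineTheta_galAinf, galAinf_iterate_frobenius, galAinf_wittFixedToAinf]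

variable {hp : valuation F p < 1}

namespace AinfRamW

variable (D : EisensteinRootW F p hp) (j : ℕ) {ρ : integerC F} (hρ : D.poly.eval₂ (twistCoeff hp j) ρ = 0)

/-! ## §2 `ϑ_{j,ρ} : A_inf(𝒪_F) → 𝒪_{ℂ_F}`, `θ ∘ φ^j` on `𝔸_inf(F)`, `ϖ ↦ ρ` -/

/-- **The twisted conjugate specialisation `ϑ_{j,ρ} : A_inf(𝒪_F) = 𝔸_inf(F)[X]/(E) → 𝒪_{ℂ_F}`**: `θ ∘ φ^j` on the
coefficients and `ϖ ↦ ρ`, well defined since `ρ` is a root of `E^{(j)} = Σ θ(φ^j a_i) X^i`.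
[cite: SerreAbelianLadic1968, Ch. III §A.5] [cite: FarguesFontaine2018, §2.2] -/
def thetaTwist : AinfRamW D →+* integerC F :=
  AdjoinRoot.lift ((fontaineTheta (integerC F) p).comp
    ((WittVector.frobenius : Ainf (p := p) F →+* Ainf (p := p) F) ^ j)) ρ (by
      rw [EisensteinRootW.eval₂_polyAinf, RingHom.comp_assoc]; exact hρ)

/-- `ϑ_{j,ρ} = θ ∘ φ^j` on `𝔸_inf(F)`. [cite: FontaineAsterisque223III, Exp. II §1.2.2] -/
theorem thetaTwist_algebraMap (a : Ainf (p := p) F) :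
    thetaTwist D j hρ (algebraMap (Ainf (p := p) F) (AinfRamW D) a) =
      fontaineTheta (integerC F) p ((⇑(WittVector.frobenius : Ainf (p := p) F →+* Ainf (p := p) F))^[j] a) := by
  rw [algebraMap_eq, thetaTwist, AdjoinRoot.lift_of, RingHom.comp_apply, RingHom.coe_pow]

/-- **`ϑ_{j,ρ}(ϖ) = ρ`.** [cite: SerreAbelianLadic1968, Ch. III §A.5] -/
@[simp] theorem thetaTwist_varpi : thetaTwist D j hρ (varpi D) = ρ := AdjoinRoot.lift_root _

/-- `ϑ_{j,ρ}` on a polynomial representative. [cite: FarguesFontaine2018, §1.2] -/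
theorem thetaTwist_mk (q : (Ainf (p := p) F)[X]) :
    thetaTwist D j hρ (AdjoinRoot.mk D.polyAinf q) =
      q.eval₂ ((fontaineTheta (integerC F) p).comp ((WittVector.frobenius : Ainf (p := p) F →+* Ainf (p := p) F) ^ j)) ρ := by
  rw [thetaTwist, AdjoinRoot.lift_mk]

/-- `ϑ_{j,ρ}` on the coefficients `W(k_F)` is `c_j`. [cite: FarguesFontaine2018, §2.2] -/
theorem thetaTwist_coeffHom_of (z : wittFixed F p) :
    thetaTwist D j hρ (coeffHom D (AdjoinRoot.of D.poly z)) = twistCoeff hp j z := by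
  rw [coeffHom_of, thetaTwist_algebraMap, twistCoeff_apply]

set_option maxHeartbeats 2000000 in
/-- **`ϑ_{j,ρ}` on the coefficient ring `𝒪_D = W(k_F)[X]/(E)`** is the map `c_j ⊗ (X ↦ ρ)`. [cite: SerreAbelianLadic1968, Ch. III §A.5] -/
theorem thetaTwist_coeffHom (x : D.Coeff) :
    thetaTwist D j hρ (coeffHom D x) = AdjoinRoot.lift (twistCoeff hp j) ρ hρ x := by
  have h : (thetaTwist D j hρ).comp (coeffHom D) = AdjoinRoot.lift (twistCoeff hp j) ρ hρ := by
    refine Ideal.Quotient.ringHom_ext (Polynomial.ringHom_ext' (RingHom.ext fun z => ?_) ?_)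
    · change thetaTwist D j hρ (coeffHom D (AdjoinRoot.of D.poly z)) =
        AdjoinRoot.lift (twistCoeff hp j) ρ hρ (AdjoinRoot.of D.poly z)
      rw [thetaTwist_coeffHom_of, AdjoinRoot.lift_of]
    · change thetaTwist D j hρ (coeffHom D (AdjoinRoot.root D.poly)) =
        AdjoinRoot.lift (twistCoeff hp j) ρ hρ (AdjoinRoot.root D.poly)
      rw [coeffHom_root, thetaTwist_varpi, AdjoinRoot.lift_root]
  exact RingHom.congr_fun h x

/-- **`ϑ_{j,ρ} ∘ σ = σ ∘ ϑ_{j,ρ}` for `σ ∈ Γ_F` with `σ(ρ) = ρ`** (`θ` is `Γ_F`-equivariant, `Γ_F` commutes with `φ^j`,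
and `σ` fixes `ϖ ∈ A_inf(𝒪_F)`). [cite: FontaineAsterisque223III, Exp. II §1.2] [cite: SerreAbelianLadic1968, Ch. III §A.5] -/
theorem coe_thetaTwist_gal (σ : absoluteGaloisGroup F) (hσ : σ • (ρ : CompletedAlgClosure F) = ρ) (x : AinfRamW D) :
    ((thetaTwist D j hρ (gal D σ x) : integerC F) : CompletedAlgClosure F) =
      σ • ((thetaTwist D j hρ x : integerC F) : CompletedAlgClosure F) := by
  have h : (integerC F).subtype.comp ((thetaTwist D j hρ).comp (gal D σ)) =
      (CompletedAlgClosure.galRingHom σ).comp ((integerC F).subtype.comp (thetaTwist D j hρ)) := by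
    refine ringHom_ext D (fun a => ?_) ?_
    · change ((thetaTwist D j hρ (gal D σ (algebraMap _ _ a)) : integerC F) : CompletedAlgClosure F) =
        CompletedAlgClosure.galRingHom σ ((thetaTwist D j hρ (algebraMap _ _ a) : integerC F) : CompletedAlgClosure F)
      rw [gal_algebraMap, thetaTwist_algebraMap, thetaTwist_algebraMap, ← galAinf_iterate_frobenius,
        fontaineTheta_galAinf, coe_galInt]; rfl
    · change ((thetaTwist D j hρ (gal D σ (varpi D)) : integerC F) : CompletedAlgClosure F) =
        CompletedAlgClosure.galRingHom σ ((thetaTwist D j hρ (varpi D) : integerC F) : CompletedAlgClosure F)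
      rw [gal_varpi, thetaTwist_varpi, ← CompletedAlgClosure.smul_def, hσ]
  exact RingHom.congr_fun h x

/-- `ϑ_{j,ρ}(σ x) = σ(ϑ_{j,ρ} x)` in `𝒪_{ℂ_F}`. [cite: FontaineAsterisque223III, Exp. II §1.2] -/
theorem thetaTwist_gal (σ : absoluteGaloisGroup F) (hσ : σ • (ρ : CompletedAlgClosure F) = ρ) (x : AinfRamW D) :
    thetaTwist D j hρ (gal D σ x) = galInt σ (thetaTwist D j hρ x) :=
  Subtype.ext (by rw [coe_thetaTwist_gal D j hρ σ hσ, coe_galInt])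

end AinfRamW

/-! ## §3 `θ ∘ φ^j ≡ Frob^j ∘ θ (mod p)` and the level-one congruence `ϑ_{j,ρ} ≡ θ_𝒪^{p^j} (mod (ρ, p, π))` -/

omit [CharZero F] in
/-- **`θ(φ a) ≡ θ(a)^p (mod p)`** on `𝔸_inf(F)`: both reduce to `(ā₀)^p` in `𝒪_{ℂ_F}/p` (Mathlib `WittVector.mk_fontaineTheta`).
[cite: FontaineAsterisque223III, Exp. II §1.2.2] -/
theorem fontaineTheta_frobenius_sub_pow_mem (a : Ainf (p := p) F) :
    fontaineTheta (integerC F) p (WittVector.frobenius a) - fontaineTheta (integerC F) p a ^ p ∈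
      Ideal.span {(p : integerC F)} := by
  rw [← Ideal.Quotient.eq_zero_iff_mem, map_sub, map_pow, WittVector.mk_fontaineTheta, WittVector.mk_fontaineTheta,
    WittVector.coeff_frobenius_charP, map_pow, sub_self]

omit [CharZero F] in
/-- **`θ(φ^j a) ≡ θ(a)^{p^j} (mod p)`.** [cite: FontaineAsterisque223III, Exp. II §1.2.2] -/
theorem fontaineTheta_iterate_frobenius_sub_pow_mem (j : ℕ) (a : Ainf (p := p) F) :
    fontaineTheta (integerC F) p ((⇑(WittVector.frobenius : Ainf (p := p) F →+* Ainf (p := p) F))^[j] a) -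
      fontaineTheta (integerC F) p a ^ p ^ j ∈ Ideal.span {(p : integerC F)} := by
  induction j with
  | zero => rw [Function.iterate_zero_apply, pow_zero, pow_one, sub_self]; exact Ideal.zero_mem _
  | succ j ih =>
    have h1 := fontaineTheta_frobenius_sub_pow_mem
      ((⇑(WittVector.frobenius : Ainf (p := p) F →+* Ainf (p := p) F))^[j] a)
    have h2 : fontaineTheta (integerC F) p ((⇑(WittVector.frobenius : Ainf (p := p) F →+* Ainf (p := p) F))^[j] a) ^ p -
        (fontaineTheta (integerC F) p a ^ p ^ j) ^ p ∈ Ideal.span {(p : integerC F)} := by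
      have h := dvd_sub_pow_of_dvd_sub (Ideal.mem_span_singleton.1 ih) 1
      try simp only [pow_one] at h
      exact Ideal.mem_span_singleton.2 ((dvd_pow_self _ (Nat.succ_ne_zero 1)).trans h)
    have h3 := Ideal.add_mem _ h1 h2
    rw [sub_add_sub_cancel] at h3
    rw [Function.iterate_succ_apply', pow_succ, pow_mul]
    exact h3

namespace AinfRamW

variable (D : EisensteinRootW F p hp) (j : ℕ) {ρ : integerC F} (hρ : D.poly.eval₂ (twistCoeff hp j) ρ = 0)

/-- `θ_𝒪` on a polynomial representative. [cite: FarguesFontaine2018, §1.2] -/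
theorem theta_mk (q : (Ainf (p := p) F)[X]) :
    theta D (AdjoinRoot.mk D.polyAinf q) = q.eval₂ (fontaineTheta (integerC F) p) D.unifC := by
  rw [mk_eq_eval₂, Polynomial.hom_eval₂, theta_varpi]
  congr 1
  exact RingHom.ext (theta_algebraMap D)

omit [CharZero F] [Fact (¬ IsUnit (p : integerC F))] [IsAdicComplete (Ideal.span {(p : integerC F)}) (integerC F)]
  [Fact p.Prime] in
/-- The value of a polynomial at `x` is congruent to its constant coefficient modulo `x`. [cite: SerreLocalFields1979, Ch. I §6] -/
theorem dvd_eval₂_sub_coeff_zero {R S : Type*} [CommRing R] [CommRing S] (i : R →+* S) (x : S) (q : R[X]) :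
    x ∣ q.eval₂ i x - i (q.coeff 0) := by
  have hX : (X : R[X]) ∣ q - C (q.coeff 0) := Polynomial.X_dvd_iff.2 (by simp)
  have h := map_dvd (Polynomial.eval₂RingHom i x) hX
  rwa [Polynomial.coe_eval₂RingHom, eval₂_X, eval₂_sub, eval₂_C] at h

/-- ★ **Level-one congruence `ϑ_{j,ρ}(x) − θ_𝒪(x)^{p^j} ∈ (ρ) + (p) + (π)`**: on a representative `q = Σ a_i X^i`,
`ϑ(x) ≡ θ(φ^j a₀) (mod ρ)`, `θ(φ^j a₀) ≡ θ(a₀)^{p^j} (mod p)`, `θ(a₀)^{p^j} ≡ θ_𝒪(x)^{p^j} (mod π)`.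
[cite: SerreAbelianLadic1968, Ch. III §A.5] [cite: FontaineAsterisque223III, Exp. II §1.2.2] -/
theorem thetaTwist_sub_theta_pow_mem (x : AinfRamW D) :
    thetaTwist D j hρ x - theta D x ^ p ^ j ∈
      Ideal.span {ρ} ⊔ Ideal.span {(p : integerC F)} ⊔ Ideal.span {D.unifC} := by
  obtain ⟨q, rfl⟩ := AdjoinRoot.mk_surjective x
  have h1 : thetaTwist D j hρ (AdjoinRoot.mk D.polyAinf q) -
      fontaineTheta (integerC F) p ((⇑(WittVector.frobenius : Ainf (p := p) F →+* Ainf (p := p) F))^[j] (q.coeff 0)) ∈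
        Ideal.span {ρ} := by
    have h := dvd_eval₂_sub_coeff_zero
      ((fontaineTheta (integerC F) p).comp ((WittVector.frobenius : Ainf (p := p) F →+* Ainf (p := p) F) ^ j)) ρ q
    rw [RingHom.comp_apply, RingHom.coe_pow, ← thetaTwist_mk D j hρ] at h
    exact Ideal.mem_span_singleton.2 h
  have h2 := fontaineTheta_iterate_frobenius_sub_pow_mem (F := F) j (q.coeff 0)
  have h3 : fontaineTheta (integerC F) p (q.coeff 0) ^ p ^ j - theta D (AdjoinRoot.mk D.polyAinf q) ^ p ^ j ∈
      Ideal.span {D.unifC} := by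
    have h := dvd_eval₂_sub_coeff_zero (fontaineTheta (integerC F) p) D.unifC q
    rw [← theta_mk D] at h
    refine Ideal.mem_span_singleton.2 (((dvd_neg).2 h).trans ?_)
    rw [neg_sub]
    exact sub_dvd_pow_sub_pow _ _ _
  have h := Ideal.add_mem _ (Ideal.add_mem _ (Ideal.mem_sup_left (Ideal.mem_sup_left h1))
    (Ideal.mem_sup_left (Ideal.mem_sup_right h2))) (Ideal.mem_sup_right h3)
  rwa [sub_add_sub_cancel, sub_add_sub_cancel] at h

omit [CharZero F] [Fact p.Prime] [IsAdicComplete (Ideal.span {(p : integerC F)}) (integerC F)]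
  [Fact (¬ IsUnit (p : integerC F))] in
/-- Elements of `(a) + (b) + (c) ⊆ 𝒪_{ℂ_F}` have norm at most `max ‖a‖ ‖b‖ ‖c‖` (ultrametric inequality). [cite: SerreLocalFields1979, Ch. II §1] -/
theorem norm_coe_le_of_mem_span_sup {a b c z : integerC F} {r : ℝ}
    (ha : ‖(a : CompletedAlgClosure F)‖ ≤ r) (hb : ‖(b : CompletedAlgClosure F)‖ ≤ r)
    (hc : ‖(c : CompletedAlgClosure F)‖ ≤ r)
    (hz : z ∈ Ideal.span {a} ⊔ Ideal.span {b} ⊔ Ideal.span {c}) : ‖(z : CompletedAlgClosure F)‖ ≤ r := by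
  have key : ∀ {d y : integerC F}, ‖(d : CompletedAlgClosure F)‖ ≤ r → y ∈ Ideal.span {d} →
      ‖(y : CompletedAlgClosure F)‖ ≤ r := fun {d y} hd hy => by
    obtain ⟨m, rfl⟩ := Ideal.mem_span_singleton'.1 hy
    rw [Subring.coe_mul, norm_mul]
    exact (mul_le_of_le_one_left (norm_nonneg _) (norm_coe_integerC_le m)).trans hd
  obtain ⟨y, hy, w, hw, rfl⟩ := Submodule.mem_sup.1 hz
  obtain ⟨u, hu, v, hv, rfl⟩ := Submodule.mem_sup.1 hy
  rw [Subring.coe_add, Subring.coe_add]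
  refine (IsUltrametricDist.norm_add_le_max _ _).trans (max_le ((IsUltrametricDist.norm_add_le_max _ _).trans
    (max_le (key ha hu) (key hb hv))) (key hc hw))

omit [Fact (¬ IsUnit (p : integerC F))] [IsAdicComplete (Ideal.span {(p : integerC F)}) (integerC F)] in
/-- `‖p‖ ≤ ‖π‖` in `ℂ_F` (`‖π‖^e = ‖p‖`, `e ≥ 1`, `‖π‖ < 1`). [cite: SerreLocalFields1979, Ch. I §6 Prop. 17] -/
theorem norm_natCast_le_norm_unifC :
    ‖(p : CompletedAlgClosure F)‖ ≤ ‖((D.unifC : integerC F) : CompletedAlgClosure F)‖ := by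
  rw [← D.norm_unifC_pow]
  conv_rhs => rw [← pow_one ‖((D.unifC : integerC F) : CompletedAlgClosure F)‖]
  exact pow_le_pow_of_le_one (norm_nonneg _) D.norm_unifC_lt_one.le D.deg_pos

/-- ★ **`‖ϑ_{j,ρ}(x) − θ_𝒪(x)^{p^j}‖ ≤ ‖π‖` for every `x ∈ A_inf(𝒪_F)`, when `‖ρ‖ ≤ ‖π‖** (e.g. `ρ` a conjugate of `π`).
[cite: SerreAbelianLadic1968, Ch. III §A.5] [cite: FontaineAsterisque223III, Exp. II §1.2.2] -/
theorem norm_coe_thetaTwist_sub_theta_pow_le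
    (hρπ : ‖(ρ : CompletedAlgClosure F)‖ ≤ ‖((D.unifC : integerC F) : CompletedAlgClosure F)‖) (x : AinfRamW D) :
    ‖((thetaTwist D j hρ x - theta D x ^ p ^ j : integerC F) : CompletedAlgClosure F)‖ ≤
      ‖((D.unifC : integerC F) : CompletedAlgClosure F)‖ :=
  norm_coe_le_of_mem_span_sup hρπ (by rw [SubringClass.coe_natCast]; exact norm_natCast_le_norm_unifC D) le_rfl
    (thetaTwist_sub_theta_pow_mem D j hρ x)

end AinfRamW

end Ring

end Literature.NumberTheory.PAdicHodge

end
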